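import Summits.RiemannHypothesis.RiemannHypothesis.Theses.RuelleBand

/-!
# RiemannHypothesis / RuelleBand — the support item `AsymptoticToZeroFreeStrip`

Route `RiemannHypothesis/RuelleBand`, item stmt-RiemannHypothesis-10740 (`AsymptoticToZeroFreeStrip`,
support, rank 9):

  `AsymptoticCriticalLine → ∃ δ : ℝ, 0 < δ ∧ ∀ s : ℂ, riemannZeta s = 0 → 1 - δ < s.re → s.re < 1 → False`.

Rung #4 of the route's ladder (`AsymptoticCriticalLine`: for every `ε > 0` only finitely many zeros
of `ζ` in the open strip have `ε ≤ |Re s − 1/2|`) already yields a zero-free vertical strip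
`1 − δ < Re s < 1` (the conclusion is `Literature.NumberTheory.LFunctions.QuasiRiemannHypothesis (1 − δ)`
unfolded, i.e. route Strip's crux `StripZeroFreeStrip` up to unfolding).

Proof (elementary): take `ε = 1/4`; the zeros with `0 < Re s < 1` and `1/4 ≤ |Re s − 1/2|` form a
finite set `F`. If `F` is empty put `δ₀ := 1`, otherwise let `s₀ ∈ F` maximise `Re` over `F`
(`Set.exists_max_image`) and put `δ₀ := 1 − Re s₀ > 0`; in both cases `Re s ≤ 1 − δ₀` on `F`.
With `δ := min (1/4) δ₀ > 0`, a zero with `1 − δ < Re s < 1` has `Re s > 3/4`, hence lies in `F`,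
hence `Re s ≤ 1 − δ₀ ≤ 1 − δ`, a contradiction.

No named facts are used; the cone is that of the route file (Mathlib + `ZetaRealAxis`).
-/

-- D-0017: a single-problem summit has `RiemannHypothesis.RiemannHypothesis` in every name by
-- design; the lakefile turns this linter off for `Summits`; repeated here so that standalone
-- elaboration is warning-free as well.
set_option linter.dupNamespace false

namespace Summit.RiemannHypothesis.RiemannHypothesis.Theorems

open Summit.RiemannHypothesis.RiemannHypothesis.Theses.RuelleBand

/-- A finite set of zeros of `ζ` inside the open critical strip stays a positive distance below the
line `Re s = 1`: there is `δ₀ > 0` with `Re s ≤ 1 − δ₀` for every `s` in the set (take the maximum of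
`Re` over the set, or `δ₀ = 1` if it is empty). Stated for an arbitrary finite set of complex numbers
with real parts `< 1`. [folklore] -/
theorem ruelleBand_exists_uniform_gap_of_finite {F : Set ℂ} (hF : F.Finite)
    (hlt : ∀ s ∈ F, s.re < 1) : ∃ δ₀ : ℝ, 0 < δ₀ ∧ ∀ s ∈ F, s.re ≤ 1 - δ₀ := by
  rcases F.eq_empty_or_nonempty with h | hne
  · exact ⟨1, one_pos, by simp [h]⟩
  · obtain ⟨s₀, hs₀, hmax⟩ := Set.exists_max_image F (fun s => s.re) hF hne
    exact ⟨1 - s₀.re, by linarith [hlt s₀ hs₀], fun s hs => by linarith [hmax s hs]⟩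

/-- **Rung #4 gives a zero-free vertical strip** (support item stmt-RiemannHypothesis-10740,
`AsymptoticToZeroFreeStrip`, of route `RuelleBand`): `AsymptoticCriticalLine → ∃ δ > 0, ζ has no
zero with 1 − δ < Re s < 1`. With `ε = 1/4` the exceptional zeros form a finite set `F`; put
`δ := min (1/4) δ₀` where `Re s ≤ 1 − δ₀` on `F`; a zero with `1 − δ < Re s < 1` would lie in `F`.
The type is literally the route decl `AsymptoticToZeroFreeStrip`. [folklore] -/
theorem ruelleBand_asymptoticToZeroFreeStrip_proof : AsymptoticToZeroFreeStrip := by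
  unfold AsymptoticToZeroFreeStrip AsymptoticCriticalLine
  intro hA
  have hF := hA (1 / 4) (by norm_num)
  obtain ⟨δ₀, hδ₀, hδF⟩ :=
    ruelleBand_exists_uniform_gap_of_finite hF (fun s hs => hs.2.2.1)
  refine ⟨min (1 / 4) δ₀, lt_min (by norm_num) hδ₀, fun s hs h1 h2 => ?_⟩
  have hmin1 : min (1 / 4 : ℝ) δ₀ ≤ 1 / 4 := min_le_left _ _
  have hmin2 : min (1 / 4 : ℝ) δ₀ ≤ δ₀ := min_le_right _ _
  have hsF : s ∈ {s : ℂ | riemannZeta s = 0 ∧ 0 < s.re ∧ s.re < 1 ∧ 1 / 4 ≤ |s.re - 1 / 2|} := by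
    refine ⟨hs, by linarith, h2, ?_⟩
    rw [abs_of_nonneg (by linarith)]
    linarith
  have := hδF s hsF
  linarith

end Summit.RiemannHypothesis.RiemannHypothesis.Theorems
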